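import Summits.CriticalPhenomena.PercolationContinuityZ3.Theorems.Transplant.SnowballSqueezeStep
import Summits.CriticalPhenomena.PercolationContinuityZ3.Theorems.Transplant.CayleyMilnorWords
import Mathlib.Analysis.SpecialFunctions.Pow.Asymptotics
import HarnessLib

/-!
# The snowball squeeze, STEP 2 part (b1): SCALES AND SPRINKLES — ball growth on transitive graphs, the next scale from stretched-exponential
# growth, the sprinkling ladder `Spr(p; λ)`, and the elementary `log y ≪ y^r` bookkeeping the tower uses (generic; kernel seams)

Proof file (`--supports stmt-CriticalPhenomena-4575`), lane `prim-bschramm`, seat `prim-bschramm-gen-1` gen 11 (GEN pen), lead g28's conditional GO #9067 for N1 STEP 2.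
builds on p205010 (kernel theorem, internal audit signed; external expert review pending) — nothing in this file uses p205010.  Def-free; no instance, no notation,
no sorry, no `@[conjecture]`; nothing about `θ(p_c)`, no witness, no named fact.

CONTENT (namespace `…Transplant.SnowballSqueeze`), the seams of the tower bookkeeping (memo SUPPLEMENT-N1 §3 S2–S3, in the prescribed-schedule form of the pen's
design note, lead bus 2026-08-29):
* §1 (`Milnor.ballVolume_mono` reused from «CayleyMilnorWords») `ballVolume_succ_le` (`|B(o, n+1)| ≤ (Δ+1)·|B(o, n)|` on a vertex-transitive graph with degrees `≤ Δ`), `log_ballVolume_succ_le`.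
* §2 `exists_scale` — from `GrowthLower` in effective form (`exp(c_G n^a) ≤ |B(o,n)|` for `n ≥ N_G`): for every `L ≥ 0` there is a scale `n′ > n`, `n′ ≥ N_G`, with
  `|B(o, n′)| ≥ e^L` and `n′ ≤ n + N_G + (L/c_G)^{1/a} + 2`.
* §3 the sprinkling ladder: `lt_spr`, `spr_lt_spr`, `sprDist_le_of_le_spr` (`q ≤ Spr(p; λ) ⇒ δ(p, q) ≤ λ`), `one_div_rpow_eq_exp` (`(1/B)^x = e^{−x log B}`).
* §4 `exists_log_le_rpow` (`A·log y + K ≤ y^r` for `y ≥ Y(A, K, r)`, `r > 0`; Mathlib `isLittleO_log_rpow_atTop`), its scaled form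
  `exists_log_le_mul_rpow` and its natural-number form `exists_log_nat_le_rpow`.
[cite: EasoHutchcroft2023, §3.1 (Spr, δ) and §4.2] [cite: Hutchcroft2016, §1 (|B(x,n)|)]
-/

noncomputable section

namespace Summit.CriticalPhenomena.PercolationContinuityZ3.Theorems.Transplant

namespace SnowballSqueeze

open SimpleGraph MeasureTheory Filter Asymptotics Literature.Barriers.CriticalPhenomena Literature.Probability.Percolation
  Literature.Probability.Percolation.Snowballing
open scoped Classical Topology

variable {V : Type}

/-! ## §1 Ball growth on a vertex-transitive graph of bounded degree -/

/-- **One more step costs a factor `Δ + 1`**: on a vertex-transitive graph with all degrees `≤ Δ`, `|B(o, n+1)| ≤ (Δ + 1)·|B(o, n)|`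
(`B(o, n+1) = {o} ∪ ⋃_{v ∼ o} B(v, n)` and all balls of radius `n` have the same volume). [cite: Hutchcroft2016, §1 (|B(x,n)|, transitive graphs)] -/
theorem ballVolume_succ_le (G : SimpleGraph V) [G.LocallyFinite] (htrans : IsGraphTransitive G) {Δ : ℕ} (hΔ : ∀ v, G.degree v ≤ Δ) (o : V) (n : ℕ) :
    ballVolume G o (n + 1) ≤ (Δ + 1) * ballVolume G o n := by
  have hU : (⋃ v ∈ G.neighborSet o, graphBall G v n) = ⋃ v ∈ G.neighborFinset o, graphBall G v n := by
    simp only [SimpleGraph.mem_neighborFinset, SimpleGraph.mem_neighborSet]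
  have hvol : ∀ v, (graphBall G v n).ncard = ballVolume G o n := fun v => ballVolume_eq_of_isGraphTransitive G htrans o v n
  rw [ballVolume, graphBall_succ, hU]
  calc ({o} ∪ ⋃ v ∈ G.neighborFinset o, graphBall G v n).ncard
      ≤ ({o} : Set V).ncard + (⋃ v ∈ G.neighborFinset o, graphBall G v n).ncard := Set.ncard_union_le _ _
    _ ≤ 1 + ∑ v ∈ G.neighborFinset o, (graphBall G v n).ncard := by
        rw [Set.ncard_singleton]; exact Nat.add_le_add_left (ncard_biUnion_le _ _) 1
    _ = 1 + ∑ _v ∈ G.neighborFinset o, ballVolume G o n := by rw [Finset.sum_congr rfl fun v _ => hvol v]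
    _ = 1 + G.degree o * ballVolume G o n := by rw [Finset.sum_const, smul_eq_mul, SimpleGraph.card_neighborFinset_eq_degree]
    _ ≤ ballVolume G o n + Δ * ballVolume G o n := Nat.add_le_add (one_le_ballVolume G o n) (Nat.mul_le_mul_right _ (hΔ o))
    _ = (Δ + 1) * ballVolume G o n := by ring

/-- Logarithmic form: `log|B(o, n+1)| ≤ log|B(o, n)| + log(Δ + 1)`. [folklore] -/
theorem log_ballVolume_succ_le (G : SimpleGraph V) [G.LocallyFinite] (htrans : IsGraphTransitive G) {Δ : ℕ} (hΔ : ∀ v, G.degree v ≤ Δ) (o : V)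
    (n : ℕ) : Real.log (ballVolume G o (n + 1) : ℝ) ≤ Real.log (ballVolume G o n : ℝ) + Real.log ((Δ : ℝ) + 1) := by
  have h1 : (1 : ℝ) ≤ ballVolume G o n := by exact_mod_cast one_le_ballVolume G o n
  have h := ballVolume_succ_le G htrans hΔ o n
  have h' : (ballVolume G o (n + 1) : ℝ) ≤ ((Δ : ℝ) + 1) * ballVolume G o n := by exact_mod_cast h
  calc Real.log (ballVolume G o (n + 1) : ℝ) ≤ Real.log (((Δ : ℝ) + 1) * ballVolume G o n) :=
        Real.log_le_log (by exact_mod_cast one_le_ballVolume G o (n + 1)) h'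
    _ = Real.log (ballVolume G o n : ℝ) + Real.log ((Δ : ℝ) + 1) := by
        rw [Real.log_mul (by positivity) (by positivity), add_comm]

/-! ## §2 The next scale from stretched-exponential growth -/

/-- **Reaching a prescribed volume**: if `exp(c_G n^a) ≤ |B(o, n)|` for all `n ≥ N_G` (`c_G, a > 0`), then for every `L ≥ 0` and every `n` there is a scale
`n′ > n`, `n′ ≥ N_G`, with `e^L ≤ |B(o, n′)|` and `n′ ≤ n + N_G + (L/c_G)^{1/a} + 2`. [folklore] -/
theorem exists_scale (G : SimpleGraph V) [G.LocallyFinite] (o : V) {cG a : ℝ} (hcG : 0 < cG) (ha : 0 < a) {NG : ℕ}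
    (hgr : ∀ n : ℕ, NG ≤ n → Real.exp (cG * (n : ℝ) ^ a) ≤ (ballVolume G o n : ℝ)) (n : ℕ) {L : ℝ} (hL : 0 ≤ L) :
    ∃ n' : ℕ, n < n' ∧ NG ≤ n' ∧ Real.exp L ≤ (ballVolume G o n' : ℝ) ∧ (n' : ℝ) ≤ n + NG + (L / cG) ^ (1 / a) + 2 := by
  set t : ℕ := ⌈(L / cG) ^ (1 / a)⌉₊ with ht
  have ht0 : (0 : ℝ) ≤ (L / cG) ^ (1 / a) := Real.rpow_nonneg (div_nonneg hL hcG.le) _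
  refine ⟨max (n + 1) (max NG t), by omega, by omega, ?_, ?_⟩
  · set n' := max (n + 1) (max NG t) with hn'
    have hn't : (L / cG) ^ (1 / a) ≤ (n' : ℝ) := (Nat.le_ceil _).trans (by exact_mod_cast (le_max_right NG t).trans (le_max_right (n + 1) _))
    have hpow : L / cG ≤ (n' : ℝ) ^ a := by
      have h := Real.rpow_le_rpow ht0 hn't ha.le
      rwa [← Real.rpow_mul (div_nonneg hL hcG.le), one_div_mul_cancel ha.ne', Real.rpow_one] at h
    have hL' : L ≤ cG * (n' : ℝ) ^ a := by rw [div_le_iff₀' hcG] at hpow; exact hpow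
    exact (Real.exp_le_exp.2 hL').trans (hgr n' (by omega))
  · have h1 : (t : ℝ) ≤ (L / cG) ^ (1 / a) + 1 := by
      have := Nat.ceil_lt_add_one ht0
      rw [← ht] at this
      linarith
    have h2 : ((max (n + 1) (max NG t) : ℕ) : ℝ) ≤ (n : ℝ) + 1 + NG + t := by
      have : max (n + 1) (max NG t) ≤ n + 1 + NG + t := by omega
      exact_mod_cast this
    linarith

/-! ## §3 The sprinkling ladder -/

/-- `p < Spr(p; λ)` for `λ > 0` and `0 < p < 1` (strict). [cite: EasoHutchcroft2023, §3.1 p. 19 (Spr)] -/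
theorem lt_spr {p lam : ℝ} (hp : 0 < p) (hp1 : p < 1) (hlam : 0 < lam) : p < spr p lam := by
  unfold spr
  have h1p : 0 < 1 - p := by linarith
  have hlt : (1 - p) ^ Real.exp lam < (1 - p) ^ (1 : ℝ) :=
    Real.rpow_lt_rpow_of_exponent_gt h1p (by linarith) (Real.one_lt_exp_iff.2 hlam)
  rw [Real.rpow_one] at hlt
  linarith

/-- `Spr(p; ·)` is strictly increasing (for `0 < p < 1`). [cite: EasoHutchcroft2023, §3.1 p. 19 (Spr)] -/
theorem spr_lt_spr {p lam mu : ℝ} (hp : 0 < p) (hp1 : p < 1) (h : lam < mu) : spr p lam < spr p mu := by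
  unfold spr
  have h1p : 0 < 1 - p := by linarith
  have hlt : (1 - p) ^ Real.exp mu < (1 - p) ^ Real.exp lam := Real.rpow_lt_rpow_of_exponent_gt h1p (by linarith) (Real.exp_lt_exp.2 h)
  linarith

/-- **Reading off the sprinkle**: `p ≤ q < 1`, `q ≤ Spr(p; λ)` ⇒ `δ(p, q) ≤ λ` (since `q = Spr(p; δ(p, q))` and `Spr(p; ·)` is increasing). [folklore] -/
theorem sprDist_le_of_le_spr {p q lam : ℝ} (hp : 0 < p) (hp1 : p < 1) (hq1 : q < 1) (hpq : p ≤ q) (h : q ≤ spr p lam) : sprDist p q ≤ lam := by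
  by_contra hlt
  push Not at hlt
  have := spr_lt_spr hp hp1 hlt
  rw [spr_sprDist hp hp1 hq1 hpq] at this
  exact absurd h (not_le.2 this)
/-- `(1/B)^x = exp(−x · log B)` for `B > 0` (the ghost-density powers of the tower). [folklore] -/
theorem one_div_rpow_eq_exp {B : ℝ} (hB : 0 < B) (x : ℝ) : (1 / B) ^ x = Real.exp (-(x * Real.log B)) := by
  rw [Real.rpow_def_of_pos (by positivity), Real.log_div one_ne_zero hB.ne', Real.log_one, zero_sub]
  ring_nf

/-! ## §4 `log y ≪ y^r` -/

/-- **`A·log y + K ≤ y^r` for all large `y`** (`r > 0`; any real `A`, `K`). [folklore] -/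
theorem exists_log_le_rpow (A K : ℝ) {r : ℝ} (hr : 0 < r) : ∃ Y : ℝ, 0 < Y ∧ ∀ y : ℝ, Y ≤ y → A * Real.log y + K ≤ y ^ r := by
  have h1 : ∀ᶠ y : ℝ in atTop, |A| * |Real.log y| ≤ (1 / 2) * y ^ r := by
    have hA : (0 : ℝ) < 1 / (2 * (|A| + 1)) := by positivity
    filter_upwards [(isLittleO_log_rpow_atTop hr).bound hA, eventually_ge_atTop (0 : ℝ)] with y hy hy0
    rw [Real.norm_eq_abs, Real.norm_eq_abs, abs_of_nonneg (Real.rpow_nonneg hy0 r)] at hy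
    have hyr : 0 ≤ y ^ r := Real.rpow_nonneg hy0 r
    calc |A| * |Real.log y| ≤ |A| * (1 / (2 * (|A| + 1)) * y ^ r) := mul_le_mul_of_nonneg_left hy (abs_nonneg A)
      _ = |A| / (|A| + 1) * ((1 / 2) * y ^ r) := by field_simp
      _ ≤ 1 * ((1 / 2) * y ^ r) := by
          refine mul_le_mul_of_nonneg_right ?_ (by positivity)
          rw [div_le_one (by positivity)]; linarith [abs_nonneg A]
      _ = (1 / 2) * y ^ r := one_mul _
  have h2 : ∀ᶠ y : ℝ in atTop, K ≤ (1 / 2) * y ^ r := by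
    have ht : Tendsto (fun y : ℝ => (1 / 2) * y ^ r) atTop atTop := (tendsto_rpow_atTop hr).const_mul_atTop (by norm_num)
    exact ht.eventually (eventually_ge_atTop K)
  obtain ⟨Y, hY⟩ := eventually_atTop.1 ((h1.and h2).and (eventually_gt_atTop (0 : ℝ)))
  refine ⟨max Y 1, by positivity, fun y hy => ?_⟩
  obtain ⟨⟨hy1, hy2⟩, -⟩ := hY y ((le_max_left Y 1).trans hy)
  have : A * Real.log y ≤ |A| * |Real.log y| := by
    calc A * Real.log y ≤ |A * Real.log y| := le_abs_self _
      _ = |A| * |Real.log y| := abs_mul _ _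
  linarith

/-- Scaled form: `A·log y + K ≤ κ·y^r` for all large `y` (`r, κ > 0`). [folklore] -/
theorem exists_log_le_mul_rpow (A K : ℝ) {κ r : ℝ} (hκ : 0 < κ) (hr : 0 < r) :
    ∃ Y : ℝ, 0 < Y ∧ ∀ y : ℝ, Y ≤ y → A * Real.log y + K ≤ κ * y ^ r := by
  obtain ⟨Y, hY0, hY⟩ := exists_log_le_rpow (A / κ) (K / κ) hr
  refine ⟨Y, hY0, fun y hy => ?_⟩
  have h := hY y hy
  have h' : A * Real.log y + K = κ * (A / κ * Real.log y + K / κ) := by field_simp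
  rw [h']
  exact mul_le_mul_of_nonneg_left h hκ.le

/-- Natural-number form: `A·(log m + 1) ≤ κ·m^r` for all large `m : ℕ` (`r, κ > 0`). [folklore] -/
theorem exists_log_nat_le_rpow (A κ : ℝ) {r : ℝ} (hκ : 0 < κ) (hr : 0 < r) :
    ∃ M : ℕ, ∀ m : ℕ, M ≤ m → A * (Real.log m + 1) ≤ κ * (m : ℝ) ^ r := by
  obtain ⟨Y, hY0, hY⟩ := exists_log_le_rpow (A / κ) (A / κ) hr
  refine ⟨⌈Y⌉₊, fun m hm => ?_⟩
  have hmY : Y ≤ (m : ℝ) := (Nat.le_ceil Y).trans (by exact_mod_cast hm)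
  have h := hY m hmY
  have h' : A * (Real.log m + 1) = κ * (A / κ * Real.log m + A / κ) := by field_simp
  rw [h']
  exact mul_le_mul_of_nonneg_left h hκ.le

end SnowballSqueeze

end Summit.CriticalPhenomena.PercolationContinuityZ3.Theorems.Transplant
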